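import Literature.Barriers.ValiantsHypothesis.NotViaSaturationsAlonTarsi
import Literature.Barriers.ValiantsHypothesis.NotViaSaturationsProofs
import Mathlib.FieldTheory.Finite.Polynomial
import Mathlib.NumberTheory.Wilson
import Mathlib.LinearAlgebra.Matrix.MvPolynomial
import Mathlib.LinearAlgebra.Matrix.NonsingularInverse
import Mathlib.Data.Nat.Choose.Multinomial
import HarnessLib

/-!
# Glynn's theorem: the Alon–Tarsi conjecture holds in dimension `p - 1` (discharge of
# `Glynn2010_AlonTarsi`)

`NotViaSaturationsAlonTarsi.lean` vendors Glynn's theorem [Glynn2010AlonTarsi, Thm. 3.2] ("For any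
odd prime `p`, the number of even Latin squares of order `p − 1` minus the number of odd Latin
squares of that order, is `(−1)^{(p−1)/2}` modulo `p`", hence nonzero) as the named fact
`Glynn2010_AlonTarsi : ∀ p, p.Prime → Odd p → AlonTarsiConjecture (p - 1)`. This file proves it
(`Glynn2010_AlonTarsi_holds`), following the printed argument (§3 of the paper):

1. (Huang–Rota / the three-parities identity, already in the tree as `latinColCount_ne_zero_iff`
   of `NotViaSaturationsProofs.lean`.) The Alon–Tarsi signed count of Latin squares of order `n` is
   nonzero iff the COLUMN-signed count `latinColCount n = Σ_L ∏_j sgn(column j)` is (Glynn passes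
   from the symbol parity to `par = rowpar + colpar` by his Cor. 2.3; the tree's `colSign_rowInv`
   is that relation).
2. (Glynn §3, the paragraph after Thm. 3.1.) Writing `det(X)^n`, `X = (x_{ij})` the generic `n × n`
   matrix, "as a sum of monomials … the exponents `e_{ij}` form an `n × n` matrix `E` that is
   doubly-stochastic … the integer coefficient for the monomial can be calculated by finding all
   possible ways to write `E` as an ordered sum of permutation matrices … if there are an odd
   number of odd permutations in this sum then the contribution … is `−1`, otherwise it is `+1`";
   for `E = J` (all ones) the ordered decompositions are the Latin squares and the sign is one of
   the three parities: `latinColCount n` **is the coefficient of `∏_{i,j} x_{ij}` in `det(X)^n`**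
   (`cast_latinColCount_eq_coeff`, over any commutative ring).
3. (Glynn's hyperdeterminant formula, [Glynn2010AlonTarsi, Thm. 3.1 with the description of
   `det_p` in §3]: over a field of characteristic `p`, `det_p(A) = det(A)^{p−1}`, where
   `(−1)^m det_p` is "the sum over all monomials … such that the monomial has its exponents summing
   to `p − 1` on each slice [row and column] … [divided] by the product of the factorials of the
   exponents".) We prove this identity in the equivalent form
   `det(X)^{p−1} = Σ_E (∏_i multinomial(E_i)) X^E` over `ZMod p`, the sum over the `m × m`
   exponent tables `E` with all row and column sums `p − 1` (`det_pow_card_sub_one_eq`; note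
   `∏_i (p−1)!/E_i! ≡ (−1)^m / E!`). Our proof of the identity is elementary and self-contained
   (Glynn refers to [13] = Glynn 1998 for it): both sides have all exponents `≤ p − 1`, so by
   `MvPolynomial.eq_zero_of_eval_eq_zero` (a reduced polynomial over `𝔽_p` vanishing everywhere is
   zero) it suffices to compare values at every matrix `A ∈ 𝔽_p^{m×m}`; the left side is
   `det(A)^{p−1} = [A invertible]`; the right side, by the multinomial theorem and the character
   sums `Σ_{x ∈ 𝔽_p} x^c` (`= −1` if `c` is a positive multiple of `p − 1`, `= 0` for
   `c < p − 1`), equals `(−1)^m Σ_{t ∈ 𝔽_p^m} ∏_i (A t)_i^{p−1} = (−1)^m #{t : (At)_i ≠ 0 ∀ i}`,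
   which is `(−1)^m (p−1)^m = 1` for invertible `A` (substitute `u = At`) and `0` for singular `A`
   (the solution set is invariant under translation by a nonzero kernel vector, so its size is a
   multiple of `p`).
4. For `m = p − 1` the table `J` has all margins `p − 1`, so the coefficient of `∏ x_{ij}` in
   `det(X)^{p−1}` is `((p−1)!)^{p−1} ≡ (−1)^{p−1}` (Wilson), i.e. `latinColCount (p−1) ≡ (−1)^{p−1}
   (mod p)` (`cast_latinColCount_prime_sub_one`) — Glynn: "the integer coefficient for each monomial
   with a doubly-stochastic exponent matrix `E`, is non-zero modulo `p`, and so it is non-zero as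
   an integer". Hence `latinColCount (p−1) ≠ 0` and, by step 1, `AlonTarsiConjecture (p − 1)`.

As a corollary, Kumar's stretching theorem in dimension `p − 1` (`kumar_stretching_prime_sub_one`
of `NotViaSaturationsAlonTarsi.lean`, there conditional on the two named facts) is now an
unconditional kernel theorem (`kumar_stretching_prime_sub_one_holds`), both
`Kumar2015_stretching_holds` (tree) and `Glynn2010_AlonTarsi_holds` (here) being proved.

The last section evaluates the sign `sgn(τ) = (−1)^{\binom{n}{2}}` of the coordinate swap on
`[n] × [n]` (left symbolic in `colSign_rowInv` / `sum_colSign_eq` of `NotViaSaturationsProofs.lean`)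
and so recovers the printed forms exactly: Glynn's Thm. 2.1 / Cor. 2.3 (R. Wilson's three-parities
relation `rowpar + colpar + sympar ≡ m/2`, as `colSign_rowInv_eq_neg_one_pow_mul`) and Thm. 3.2 with
its value, `Σ_L sign(L) ≡ (−1)^{(p−1)/2} (mod p)` over the Latin squares of order `p − 1`
(`glynn2010_thm_3_2`).

What is NOT here: Drisko's case `p + 1` (`Drisko1997_AlonTarsi`, still a named fact); Glynn's
hypercube generality of `det_p` (only square matrices are needed); Rota's basis conjecture
(Glynn's Thm. 3.3, via Huang–Rota/Onn — not in the tree's vocabulary).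

## References

* [Glynn2010AlonTarsi] D. G. Glynn, *The conjectures of Alon–Tarsi and Rota in dimension prime
  minus one*, SIAM J. Discrete Math. 24 (2010) 394–399: §2 (Thm. 2.1, Def. 2.2, Cor. 2.3), §3
  (the description of `det_p`, Thm. 3.1, the decomposition paragraph, Thm. 3.2, Cor. 3.4).
* [Kumar2015] S. Kumar, Compositio Math. 151 (2015), Rem. 4.5 (column-signed count, Huang–Rota).

## Mathlib

`Matrix.mvPolynomialX` / `Matrix.eval_det_mvPolynomialX` (the generic matrix),
`Finset.sum_pow_eq_sum_piAntidiag` (multinomial theorem), `FiniteField.sum_pow_lt_card_sub_one`,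
`ZMod.pow_card_sub_one_eq_one`, `ZMod.wilsons_lemma`, `MvPolynomial.eq_zero_of_eval_eq_zero`
(reduced polynomials over a finite field are determined by their values),
`Matrix.exists_mulVec_eq_zero_iff`, `Matrix.mulVec_{injective,surjective}_iff_isUnit`;
`Equiv.Perm.cycleType_prime_order`, `Equiv.Perm.sum_cycleType`, `Equiv.Perm.sign_of_cycleType`
(sign of an involution from its support). Note: `ℤˣ`-valued powers are stated through `ℤ`
(`((… : ℤˣ) : ℤ) = (-1)^k`) because `Int.instUnitsPow` (Mathlib's `Pow ℤˣ R`) shadows `Monoid.Pow`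
for rewriting.
-/

noncomputable section

open Equiv Finset MvPolynomial Matrix

namespace Literature.Barriers.ValiantsHypothesis

open Literature.NumberTheory.DiophantineGeometry Literature.Computability.AlgebraicComplexity
  Literature.Computability.AlgebraicComplexity.Kumar2015 Literature.Computability.Complexity

/-! ### Step 2: the column-signed count of Latin squares is the coefficient of `∏ x_{ij}` in `det(X)^n` -/

section Coefficient

variable {m : ℕ}

/-- The monomial of the term of `det(X)^m` indexed by an `m`-tuple of permutations
`f = (σ_k)_k`: `∏_k ∏_i x_{σ_k(i), i}`. [folklore] -/
private theorem prod_prod_X_perm_eq_monomial (S : Type*) [CommRing S] (f : Fin m → Perm (Fin m)) :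
    (∏ k : Fin m, ∏ i : Fin m, (X ((f k) i, i) : MvPolynomial (Fin m × Fin m) S)) =
      monomial (∑ k : Fin m, ∑ i : Fin m, Finsupp.single ((f k) i, i) 1) 1 := by
  rw [monomial_sum_index, C_1, one_mul]
  refine Finset.prod_congr rfl fun k _ => ?_
  rw [monomial_sum_index, C_1, one_mul]
  rfl

/-- The exponent of `x_{a,b}` in the term indexed by `f = (σ_k)_k` counts the `k` with
`σ_k(b) = a`. [folklore] -/
private theorem sum_sum_single_apply (f : Fin m → Perm (Fin m)) (a b : Fin m) :
    (∑ k : Fin m, ∑ i : Fin m, Finsupp.single ((f k) i, i) (1 : ℕ)) (a, b) =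
      (univ.filter fun k => f k b = a).card := by
  classical
  simp only [Finsupp.coe_finsetSum, Finset.sum_apply, Finsupp.single_apply, Prod.mk.injEq]
  rw [Finset.card_eq_sum_ones, Finset.sum_filter]
  refine Finset.sum_congr rfl fun k _ => ?_
  rw [Finset.sum_eq_single b]
  · simp
  · intro i _ hi
    rw [if_neg fun h => hi h.2]
  · exact fun h => absurd (Finset.mem_univ b) h

/-- The term indexed by `f = (σ_k)_k` is the multilinear monomial `∏_{i,j} x_{ij}` iff the
permutation matrices of the `σ_k` sum to the all-ones matrix, i.e. iff for every `b` the map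
`k ↦ σ_k(b)` is a bijection (the array `(i,k) ↦ σ_k(i)` is a Latin square with columns `σ_k`).
[cite: Glynn2010AlonTarsi, §3 (the paragraph following Thm. 3.1)] -/
theorem sum_sum_single_eq_allOnes_iff (f : Fin m → Perm (Fin m)) :
    (∑ k : Fin m, ∑ i : Fin m, Finsupp.single ((f k) i, i) (1 : ℕ)) = allOnes m m ↔
      ∀ b : Fin m, Function.Bijective fun k => f k b := by
  classical
  constructor
  · intro h b
    exact (bijective_iff_card_filter_eq_one _).mp fun a => by
      rw [← sum_sum_single_apply, h, allOnes_apply]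
  · intro h
    ext ⟨a, b⟩
    rw [sum_sum_single_apply, allOnes_apply]
    exact (bijective_iff_card_filter_eq_one _).mpr (h b) a

/-- **The coefficient of `∏_{i,j} x_{ij}` in `det(X)^m`**, `X` the generic `m × m` matrix, is the
signed count `Σ ∏_k sgn(σ_k)` over the `m`-tuples of permutations whose permutation matrices sum
to the all-ones matrix. [cite: Glynn2010AlonTarsi, §3 (the paragraph following Thm. 3.1)] -/
theorem coeff_allOnes_det_pow (S : Type*) [CommRing S] :
    coeff (allOnes m m) ((mvPolynomialX (Fin m) (Fin m) S).det ^ m) =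
      ∑ f : Fin m → Perm (Fin m),
        if (∀ b : Fin m, Function.Bijective fun k => f k b)
        then (((∏ k, Perm.sign (f k) : ℤˣ) : ℤ) : S) else 0 := by
  classical
  have hdet : (mvPolynomialX (Fin m) (Fin m) S).det =
      ∑ σ : Perm (Fin m), C (((Perm.sign σ : ℤˣ) : ℤ) : S) * ∏ i, X (σ i, i) := by
    rw [Matrix.det_apply']
    refine Finset.sum_congr rfl fun σ _ => ?_
    rw [← map_intCast (C : S →+* MvPolynomial (Fin m × Fin m) S)]
    rfl
  have hpow : ∀ x : MvPolynomial (Fin m × Fin m) S, x ^ m = ∏ _k : Fin m, x := fun x => by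
    rw [Finset.prod_const, Finset.card_univ, Fintype.card_fin]
  rw [hdet, hpow, Fintype.prod_sum, coeff_sum]
  refine Finset.sum_congr rfl fun f _ => ?_
  rw [Finset.prod_mul_distrib, ← map_prod C, prod_prod_X_perm_eq_monomial, coeff_C_mul,
    coeff_monomial, Units.coe_prod, Int.cast_prod]
  by_cases h : ∀ b, Function.Bijective fun k => f k b
  · rw [if_pos ((sum_sum_single_eq_allOnes_iff f).mpr h), if_pos h, mul_one]
  · rw [if_neg (fun h' => h ((sum_sum_single_eq_allOnes_iff f).mp h')), if_neg h, mul_zero]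

/-- **Latin squares as ordered decompositions of `J` into permutation matrices** (Glynn §3:
"Each way of writing `E [= J]` as an ordered sum of `p − 1` permutation matrices of side `p − 1`
corresponds to a Latin square … and there is a bijective correspondence between the ways and the
Latin squares"): the column-signed count `latinColCount m = Σ_L ∏_j sgn(col_j L)` equals the signed
count of the `m`-tuples `(σ_k)` with `Σ_k P_{σ_k} = J`, via `L(i,k) = σ_k(i)`.
[cite: Glynn2010AlonTarsi, §3 (the paragraph following Thm. 3.1)] -/
theorem cast_latinColCount_eq_sum (S : Type*) [CommRing S] (m : ℕ) :
    ((latinColCount m : ℤ) : S) = ∑ f : Fin m → Perm (Fin m),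
        if (∀ b : Fin m, Function.Bijective fun k => f k b)
        then (((∏ k, Perm.sign (f k) : ℤˣ) : ℤ) : S) else 0 := by
  classical
  rw [latinColCount, Int.cast_sum, ← Finset.sum_filter]
  symm
  refine Finset.sum_nbij' (fun f => fun i k => f k i)
    (fun R => fun k => if h : Function.Bijective (fun i => R i k) then Equiv.ofBijective _ h else 1)
    ?_ ?_ ?_ ?_ ?_
  · intro f hf
    rw [Finset.mem_filter] at hf ⊢
    exact ⟨Finset.mem_univ _, fun i => hf.2 i, fun k => (f k).injective⟩
  · intro R hR
    rw [Finset.mem_filter] at hR ⊢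
    refine ⟨Finset.mem_univ _, fun b => ?_⟩
    have hb : (fun k => (if h : Function.Bijective (fun i => R i k) then Equiv.ofBijective _ h
        else (1 : Perm (Fin m))) b) = R b := by
      funext k
      rw [dif_pos (Finite.injective_iff_bijective.mp (hR.2.2 k))]
      rfl
    rw [hb]
    exact hR.2.1 b
  · intro f hf
    funext k
    ext i
    dsimp only
    rw [dif_pos (f k).bijective]
    rfl
  · intro R hR
    rw [Finset.mem_filter] at hR
    funext i k
    dsimp only
    rw [dif_pos (Finite.injective_iff_bijective.mp (hR.2.2 k))]
    rfl
  · intro f hf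
    rw [rectColSign, Units.coe_prod, Units.coe_prod, Int.cast_prod, Int.cast_prod]
    refine Finset.prod_congr rfl fun k _ => ?_
    rw [seqSign_coe_perm]

/-- **`latinColCount m` is the coefficient of `∏_{i,j} x_{ij}` in `det(X)^m`** (over any
commutative ring `S`, `X` the generic `m × m` matrix `Matrix.mvPolynomialX`).
[cite: Glynn2010AlonTarsi, §3 (the paragraph following Thm. 3.1)] -/
theorem cast_latinColCount_eq_coeff (S : Type*) [CommRing S] (m : ℕ) :
    ((latinColCount m : ℤ) : S) = coeff (allOnes m m) ((mvPolynomialX (Fin m) (Fin m) S).det ^ m) := by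
  rw [cast_latinColCount_eq_sum S m, coeff_allOnes_det_pow S]

end Coefficient

/-! ### Step 3: Glynn's identity `det(X)^{p-1} = Σ_E (∏_i multinomial E_i) X^E` over `ZMod p` -/

section Glynn

variable {p : ℕ} [hp : Fact p.Prime] {m : ℕ}

/-- `Σ_{x ∈ 𝔽_p} x^{p-1} = p - 1 = -1`. [folklore] -/
private theorem sum_pow_card_sub_one_eq_neg_one : ∑ x : ZMod p, x ^ (p - 1) = -1 := by
  classical
  have h : ∀ x : ZMod p, x ^ (p - 1) = if x ≠ 0 then 1 else 0 := fun x => by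
    split_ifs with hx
    · exact ZMod.pow_card_sub_one_eq_one hx
    · rw [not_not] at hx
      rw [hx, zero_pow (Nat.sub_ne_zero_of_lt hp.out.one_lt)]
  simp_rw [h]
  rw [Finset.sum_boole, Finset.filter_ne', Finset.card_erase_of_mem (Finset.mem_univ _),
    Finset.card_univ, ZMod.card, Nat.cast_sub hp.out.one_le, ZMod.natCast_self, Nat.cast_one,
    zero_sub]

/-- **The character sum** `Σ_{t ∈ 𝔽_p^m} ∏_j t_j^{c_j}` for exponents with `Σ_j c_j = m (p-1)`:
it is `(-1)^m` if every `c_j = p - 1` and `0` otherwise (some `c_j < p - 1`, and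
`Σ_{x ∈ 𝔽_p} x^c = 0` for `c < p - 1`). [folklore] -/
private theorem sum_prod_pow_eq (c : Fin m → ℕ) (hc : ∑ j, c j = m * (p - 1)) :
    ∑ t : Fin m → ZMod p, ∏ j, t j ^ c j = if (∀ j, c j = p - 1) then (-1) ^ m else 0 := by
  classical
  rw [← Fintype.prod_sum fun j (x : ZMod p) => x ^ c j]
  split_ifs with h
  · rw [Finset.prod_congr rfl fun j _ => by rw [h j, sum_pow_card_sub_one_eq_neg_one],
      Finset.prod_const, Finset.card_univ, Fintype.card_fin]
  · have hlt : ∃ j, c j < p - 1 := by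
      by_contra hcon
      push Not at hcon
      apply h
      have heq := (Finset.sum_eq_sum_iff_of_le (s := (univ : Finset (Fin m)))
        (f := fun _ => p - 1) (g := c) (fun j _ => hcon j)).mp (by
          rw [hc, Finset.sum_const, Finset.card_univ, Fintype.card_fin, smul_eq_mul])
      exact fun j => (heq j (Finset.mem_univ j)).symm
    obtain ⟨j₀, hj₀⟩ := hlt
    refine Finset.prod_eq_zero (Finset.mem_univ j₀) ?_
    apply FiniteField.sum_pow_lt_card_sub_one
    rwa [ZMod.card]

/-- **Expansion of `Σ_t ∏_i (Σ_j a_{ij} t_j)^{p-1}`** by the multinomial theorem and the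
character sums: only the exponent tables `E` (row `i` = the exponents chosen in the `i`-th factor,
row sums `p - 1`) whose column sums are all `p - 1` survive, each with weight
`(-1)^m ∏_i multinomial(E_i)`. This is the evaluation of Glynn's formula for `(-1)^m det_p`.
[cite: Glynn2010AlonTarsi, §3 (description of `det_p` via exponent tables)] -/
theorem sum_prod_linear_pow (A : Matrix (Fin m) (Fin m) (ZMod p)) :
    ∑ t : Fin m → ZMod p, ∏ i, (∑ j, A i j * t j) ^ (p - 1) =
      (-1) ^ m * ∑ E ∈ (Fintype.piFinset fun _ : Fin m =>
          (univ : Finset (Fin m)).piAntidiag (p - 1)).filter (fun E => ∀ j, ∑ i, E i j = p - 1),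
        (∏ i, (Nat.multinomial univ (E i) : ZMod p)) * ∏ i, ∏ j, A i j ^ E i j := by
  classical
  have hrow : ∀ (t : Fin m → ZMod p) (i : Fin m), (∑ j, A i j * t j) ^ (p - 1) =
      ∑ k ∈ (univ : Finset (Fin m)).piAntidiag (p - 1),
        ((Nat.multinomial univ k : ZMod p) * ∏ j, A i j ^ k j) * ∏ j, t j ^ k j := fun t i => by
    rw [Finset.sum_pow_eq_sum_piAntidiag]
    refine Finset.sum_congr rfl fun k _ => ?_
    rw [mul_assoc, ← Finset.prod_mul_distrib]
    simp_rw [mul_pow]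
  have hsplit : ∀ (t : Fin m → ZMod p) (E : Fin m → Fin m → ℕ),
      ∏ i, (((Nat.multinomial univ (E i) : ZMod p) * ∏ j, A i j ^ E i j) * ∏ j, t j ^ E i j) =
        ((∏ i, (Nat.multinomial univ (E i) : ZMod p)) * ∏ i, ∏ j, A i j ^ E i j) *
          ∏ j, t j ^ (∑ i, E i j) := fun t E => by
    rw [Finset.prod_mul_distrib, Finset.prod_mul_distrib]
    congr 1
    rw [Finset.prod_comm]
    exact Finset.prod_congr rfl fun j _ => Finset.prod_pow_eq_pow_sum _ _ _
  simp_rw [hrow, Finset.prod_univ_sum, hsplit]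
  rw [Finset.sum_comm]
  simp_rw [← Finset.mul_sum]
  rw [Finset.mul_sum, Finset.sum_filter]
  refine Finset.sum_congr rfl fun E hE => ?_
  have hErow : ∀ i, ∑ j, E i j = p - 1 := fun i =>
    (Finset.mem_piAntidiag.mp (Fintype.mem_piFinset.mp hE i)).1
  have hEsum : ∑ j, ∑ i, E i j = m * (p - 1) := by
    rw [Finset.sum_comm, Finset.sum_congr rfl fun i _ => hErow i, Finset.sum_const,
      Finset.card_univ, Fintype.card_fin, smul_eq_mul]
  rw [sum_prod_pow_eq (fun j => ∑ i, E i j) hEsum]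
  by_cases h : ∀ j, ∑ i, E i j = p - 1
  · rw [if_pos h, if_pos h, mul_comm]
  · rw [if_neg h, if_neg h, mul_zero]

/-- **Translation invariance in the singular case**: if `A v = 0` with `v ≠ 0`, the number of
`t ∈ 𝔽_p^m` with all coordinates of `A t` nonzero is a multiple of `p` (the solution set is a
union of cosets of the line `𝔽_p v`: shear `t ↦ (t - (t_{j₀}/v_{j₀}) v, t_{j₀}/v_{j₀})`).
[folklore] -/
private theorem dvd_card_filter_mulVec_ne_zero (A : Matrix (Fin m) (Fin m) (ZMod p)) (v : Fin m → ZMod p)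
    (hv0 : v ≠ 0) (hv : A *ᵥ v = 0) :
    p ∣ (univ.filter fun t : Fin m → ZMod p => ∀ i, (A *ᵥ t) i ≠ 0).card := by
  classical
  obtain ⟨j₀, hj₀⟩ : ∃ j, v j ≠ 0 := by
    by_contra h
    push Not at h
    exact hv0 (funext h)
  have hinv : ∀ (t : Fin m → ZMod p) (c : ZMod p), A *ᵥ (t + c • v) = A *ᵥ t := fun t c => by
    rw [Matrix.mulVec_add, Matrix.mulVec_smul, hv, smul_zero, add_zero]
  let P : (Fin m → ZMod p) → Prop := fun t => ∀ i, (A *ᵥ t) i ≠ 0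
  have hshear : ∀ t : Fin m → ZMod p, (t + (-(t j₀ / v j₀)) • v) j₀ = 0 := fun t => by
    simp only [Pi.add_apply, Pi.smul_apply, smul_eq_mul, neg_mul, div_mul_cancel₀ _ hj₀,
      add_neg_cancel]
  let e : {t // P t} ≃ {t // P t ∧ t j₀ = 0} × ZMod p :=
    { toFun := fun t => (⟨t.1 + (-(t.1 j₀ / v j₀)) • v,
          fun i => by rw [hinv]; exact t.2 i, hshear t.1⟩, t.1 j₀ / v j₀)
      invFun := fun sc => ⟨sc.1.1 + sc.2 • v, fun i => by rw [hinv]; exact sc.1.2.1 i⟩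
      left_inv := fun t => by
        apply Subtype.ext
        dsimp only
        rw [neg_smul, neg_add_cancel_right]
      right_inv := fun sc => by
        obtain ⟨⟨s, hs, hs0⟩, c⟩ := sc
        have hc : (s + c • v) j₀ / v j₀ = c := by
          rw [Pi.add_apply, Pi.smul_apply, smul_eq_mul, hs0, zero_add, mul_div_cancel_right₀ _ hj₀]
        refine Prod.ext (Subtype.ext ?_) hc
        dsimp only
        rw [hc, neg_smul, add_neg_cancel_right] }
  rw [← Fintype.card_subtype, Fintype.card_congr e, Fintype.card_prod, ZMod.card]
  exact Dvd.intro_left _ rfl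

/-- **Counting**: `Σ_{t ∈ 𝔽_p^m} ∏_i (A t)_i^{p-1} = #{t : (At)_i ≠ 0 ∀ i} = (-1)^m det(A)^{p-1}`
in `𝔽_p` — `(p-1)^m` solutions for invertible `A` (substitute `u = A t`), a multiple of `p` for
singular `A`. [folklore] -/
private theorem sum_prod_mulVec_pow (A : Matrix (Fin m) (Fin m) (ZMod p)) :
    ∑ t : Fin m → ZMod p, ∏ i, (A *ᵥ t) i ^ (p - 1) = (-1) ^ m * A.det ^ (p - 1) := by
  classical
  have hp1 : p - 1 ≠ 0 := Nat.sub_ne_zero_of_lt hp.out.one_lt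
  have hind : ∀ t : Fin m → ZMod p,
      ∏ i, (A *ᵥ t) i ^ (p - 1) = if (∀ i, (A *ᵥ t) i ≠ 0) then 1 else 0 := fun t => by
    by_cases h : ∀ i, (A *ᵥ t) i ≠ 0
    · rw [if_pos h]
      exact Finset.prod_eq_one fun i _ => ZMod.pow_card_sub_one_eq_one (h i)
    · rw [if_neg h]
      push Not at h
      obtain ⟨i, hi⟩ := h
      exact Finset.prod_eq_zero (Finset.mem_univ i) (by rw [hi, zero_pow hp1])
  simp_rw [hind]
  rw [Finset.sum_boole]
  by_cases hA : A.det = 0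
  · rw [hA, zero_pow hp1, mul_zero]
    obtain ⟨v, hv0, hv⟩ := Matrix.exists_mulVec_eq_zero_iff.mpr hA
    exact (ZMod.natCast_eq_zero_iff _ _).mpr (dvd_card_filter_mulVec_ne_zero A v hv0 hv)
  · have hU : IsUnit A := (Matrix.isUnit_iff_isUnit_det A).mpr (isUnit_iff_ne_zero.mpr hA)
    have hbij : Function.Bijective A.mulVec :=
      ⟨Matrix.mulVec_injective_iff_isUnit.mpr hU, Matrix.mulVec_surjective_iff_isUnit.mpr hU⟩
    rw [ZMod.pow_card_sub_one_eq_one hA, mul_one]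
    have hcard : (univ.filter fun t : Fin m → ZMod p => ∀ i, (A *ᵥ t) i ≠ 0).card =
        (Fintype.piFinset fun _ : Fin m => (univ : Finset (ZMod p)).erase 0).card := by
      refine Finset.card_nbij A.mulVec ?_ hbij.1.injOn ?_
      · intro t ht
        rw [Finset.mem_coe, Finset.mem_filter] at ht
        rw [Finset.mem_coe, Fintype.mem_piFinset]
        exact fun i => Finset.mem_erase.mpr ⟨ht.2 i, Finset.mem_univ _⟩
      · intro u hu
        obtain ⟨t, rfl⟩ := hbij.2 u
        rw [Finset.mem_coe, Fintype.mem_piFinset] at hu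
        refine ⟨t, ?_, rfl⟩
        rw [Finset.mem_coe, Finset.mem_filter]
        exact ⟨Finset.mem_univ _, fun i => (Finset.mem_erase.mp (hu i)).1⟩
    rw [hcard, Fintype.card_piFinset, Finset.prod_const, Finset.card_univ, Fintype.card_fin,
      Finset.card_erase_of_mem (Finset.mem_univ _), Finset.card_univ, ZMod.card, Nat.cast_pow,
      Nat.cast_sub hp.out.one_le, ZMod.natCast_self, Nat.cast_one, zero_sub]

/-- **Values of Glynn's sum**: at every matrix `A ∈ 𝔽_p^{m×m}`,
`Σ_E (∏_i multinomial E_i) A^E = det(A)^{p-1}` (`E` over the exponent tables with all row and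
column sums `p - 1`). [cite: Glynn2010AlonTarsi, Thm. 3.1] -/
theorem glynnSum_eval (A : Matrix (Fin m) (Fin m) (ZMod p)) :
    ∑ E ∈ (Fintype.piFinset fun _ : Fin m =>
          (univ : Finset (Fin m)).piAntidiag (p - 1)).filter (fun E => ∀ j, ∑ i, E i j = p - 1),
        (∏ i, (Nat.multinomial univ (E i) : ZMod p)) * ∏ i, ∏ j, A i j ^ E i j = A.det ^ (p - 1) := by
  have h1 := sum_prod_linear_pow A
  have h2 : ∑ t : Fin m → ZMod p, ∏ i, (∑ j, A i j * t j) ^ (p - 1) =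
      ∑ t : Fin m → ZMod p, ∏ i, (A *ᵥ t) i ^ (p - 1) := by
    rfl
  rw [h2, sum_prod_mulVec_pow] at h1
  exact (mul_left_cancel₀ (pow_ne_zero _ (neg_ne_zero.mpr one_ne_zero)) h1).symm

/-- The generic determinant is multilinear: every variable has degree `≤ 1` in `det(X)`.
[folklore] -/
private theorem degreeOf_det_mvPolynomialX_le (v : Fin m × Fin m) :
    degreeOf v (mvPolynomialX (Fin m) (Fin m) (ZMod p)).det ≤ 1 := by
  classical
  rw [Matrix.det_apply']
  refine (degreeOf_sum_le _ _ _).trans (Finset.sup_le fun σ _ => ?_)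
  rw [← map_intCast (C : ZMod p →+* MvPolynomial (Fin m × Fin m) (ZMod p))]
  refine (degreeOf_C_mul_le _ _ _).trans ((degreeOf_prod_le _ _ _).trans ?_)
  simp only [mvPolynomialX_apply]
  rw [Finset.sum_eq_single v.2]
  · rw [degreeOf_X]
    split_ifs <;> simp
  · intro i _ hi
    rw [degreeOf_X, if_neg]
    intro h
    exact hi (congrArg Prod.snd h).symm
  · exact fun h => absurd (Finset.mem_univ _) h

/-- The monomial `X^E = ∏_{i,j} x_{ij}^{E_{ij}}` of an exponent table. [folklore] -/
private theorem prod_prod_X_pow_eq_monomial (E : Fin m → Fin m → ℕ) :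
    (∏ i : Fin m, ∏ j : Fin m, (X (i, j) : MvPolynomial (Fin m × Fin m) (ZMod p)) ^ E i j) =
      monomial (∑ i : Fin m, ∑ j : Fin m, Finsupp.single (i, j) (E i j)) 1 := by
  rw [monomial_sum_index, C_1, one_mul]
  refine Finset.prod_congr rfl fun i _ => ?_
  rw [monomial_sum_index, C_1, one_mul]
  exact Finset.prod_congr rfl fun j _ => X_pow_eq_monomial

/-- The exponent of `x_{ab}` in `X^E` is `E_{ab}`. [folklore] -/
private theorem sum_sum_single_table_apply (E : Fin m → Fin m → ℕ) (a b : Fin m) :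
    (∑ i : Fin m, ∑ j : Fin m, Finsupp.single (i, j) (E i j)) (a, b) = E a b := by
  classical
  simp only [Finsupp.coe_finsetSum, Finset.sum_apply, Finsupp.single_apply, Prod.mk.injEq]
  rw [Finset.sum_eq_single a]
  · rw [Finset.sum_eq_single b]
    · simp
    · intro j _ hj
      rw [if_neg fun h => hj h.2]
    · exact fun h => absurd (Finset.mem_univ b) h
  · intro i _ hi
    exact Finset.sum_eq_zero fun j _ => if_neg fun h => hi h.1
  · exact fun h => absurd (Finset.mem_univ a) h

/-- Every variable has degree `≤ p - 1` in Glynn's sum (the entries of an exponent table with row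
sums `p - 1` are `≤ p - 1`). [folklore] -/
private theorem degreeOf_glynnSum_le (v : Fin m × Fin m) :
    degreeOf v (∑ E ∈ (Fintype.piFinset fun _ : Fin m =>
          (univ : Finset (Fin m)).piAntidiag (p - 1)).filter (fun E => ∀ j, ∑ i, E i j = p - 1),
        C (∏ i, (Nat.multinomial univ (E i) : ZMod p)) *
          ∏ i, ∏ j, (X (i, j) : MvPolynomial (Fin m × Fin m) (ZMod p)) ^ E i j) ≤ p - 1 := by
  classical
  refine (degreeOf_sum_le _ _ _).trans (Finset.sup_le fun E hE => ?_)
  refine (degreeOf_C_mul_le _ _ _).trans ((degreeOf_prod_le _ _ _).trans ?_)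
  have hErow : ∑ j, E v.1 j = p - 1 :=
    (Finset.mem_piAntidiag.mp (Fintype.mem_piFinset.mp (Finset.mem_filter.mp hE).1 v.1)).1
  calc ∑ i, degreeOf v (∏ j, (X (i, j) : MvPolynomial (Fin m × Fin m) (ZMod p)) ^ E i j)
      ≤ ∑ i, ∑ j, degreeOf v ((X (i, j) : MvPolynomial (Fin m × Fin m) (ZMod p)) ^ E i j) :=
        Finset.sum_le_sum fun i _ => degreeOf_prod_le _ _ _
    _ = ∑ i, ∑ j, if v = (i, j) then E i j else 0 := by
        refine Finset.sum_congr rfl fun i _ => Finset.sum_congr rfl fun j _ => ?_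
        split_ifs with h
        · rw [h]
          exact degreeOf_X_self_pow _ _
        · exact degreeOf_X_pow_of_ne _ h
    _ = E v.1 v.2 := by
        rw [← Fintype.sum_prod_type' fun i j => if v = (i, j) then E i j else 0]
        simp only [Prod.mk.eta, Finset.sum_ite_eq, Finset.mem_univ, if_true]
    _ ≤ ∑ j, E v.1 j := Finset.single_le_sum (fun _ _ => Nat.zero_le _) (Finset.mem_univ _)
    _ = p - 1 := hErow

/-- **Glynn's hyperdeterminant identity** [Glynn2010AlonTarsi, Thm. 3.1: "If `A` is an `m × m`
matrix over a field of characteristic `p`, then `det_p(A) = det(A^{p−1})`" `= det(A)^{p-1}`, with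
`(−1)^m det_p(A) = Σ_E A^E / E!` over the exponent matrices `E` with all row and column sums
`p − 1`], in the form: over `ZMod p`, for the generic `m × m` matrix `X`,
`det(X)^{p-1} = Σ_E (∏_i multinomial(E_i)) · X^E` (note `∏_i (p−1)!/E_i! = (−1)^m/E!` by
Wilson). Proof: both sides have all exponents `≤ p - 1` and agree at every point of
`𝔽_p^{m×m}` (`glynnSum_eval`), so they are equal (`MvPolynomial.eq_zero_of_eval_eq_zero`).
[cite: Glynn2010AlonTarsi, Thm. 3.1] -/
theorem det_pow_card_sub_one_eq (m : ℕ) :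
    (mvPolynomialX (Fin m) (Fin m) (ZMod p)).det ^ (p - 1) =
      ∑ E ∈ (Fintype.piFinset fun _ : Fin m =>
          (univ : Finset (Fin m)).piAntidiag (p - 1)).filter (fun E => ∀ j, ∑ i, E i j = p - 1),
        C (∏ i, (Nat.multinomial univ (E i) : ZMod p)) *
          ∏ i, ∏ j, (X (i, j) : MvPolynomial (Fin m × Fin m) (ZMod p)) ^ E i j := by
  classical
  rw [← sub_eq_zero]
  apply MvPolynomial.eq_zero_of_eval_eq_zero
  · intro s
    rw [map_sub, map_pow, Matrix.eval_det_mvPolynomialX, sub_eq_zero,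
      ← glynnSum_eval (Matrix.of fun i j => s (i, j))]
    simp only [map_sum, map_mul, eval_C, map_prod, map_pow, eval_X, Matrix.of_apply]
  · rw [ZMod.card, mem_restrictDegree_iff_sup]
    intro v
    rw [← degreeOf_def]
    refine (degreeOf_sub_le _ _ _).trans (max_le ?_ (degreeOf_glynnSum_le v))
    refine (degreeOf_pow_le _ _ _).trans ?_
    simpa using Nat.mul_le_mul_left (p - 1) (degreeOf_det_mvPolynomialX_le (p := p) v)

/-- **The multilinear coefficient of `det(X)^{p-1}` for `m = p - 1`** is `((p-1)!)^{p-1} = (-1)^{p-1}`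
(the all-ones table `J` has all margins `p − 1`; Wilson). Glynn: "the integer coefficient for each
monomial with a doubly-stochastic exponent matrix `E`, is non-zero modulo `p`".
[cite: Glynn2010AlonTarsi, §3 (the paragraph following Thm. 3.1)] -/
theorem coeff_allOnes_det_pow_card_sub_one :
    coeff (allOnes (p - 1) (p - 1))
      ((mvPolynomialX (Fin (p - 1)) (Fin (p - 1)) (ZMod p)).det ^ (p - 1)) = (-1) ^ (p - 1) := by
  classical
  rw [det_pow_card_sub_one_eq, coeff_sum]
  have hterm : ∀ E : Fin (p - 1) → Fin (p - 1) → ℕ,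
      coeff (allOnes (p - 1) (p - 1)) (C (∏ i, (Nat.multinomial univ (E i) : ZMod p)) *
        ∏ i, ∏ j, (X (i, j) : MvPolynomial (Fin (p - 1) × Fin (p - 1)) (ZMod p)) ^ E i j) =
        if E = fun _ _ => 1 then (∏ i, (Nat.multinomial univ (E i) : ZMod p)) else 0 := fun E => by
    rw [coeff_C_mul, prod_prod_X_pow_eq_monomial, coeff_monomial]
    have hiff : (∑ i : Fin (p - 1), ∑ j : Fin (p - 1), Finsupp.single (i, j) (E i j)) =
        allOnes (p - 1) (p - 1) ↔ E = fun _ _ => 1 := by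
      constructor
      · intro h
        funext a b
        rw [← sum_sum_single_table_apply E a b, h, allOnes_apply]
      · intro h
        ext ⟨a, b⟩
        rw [sum_sum_single_table_apply, allOnes_apply, h]
    by_cases h : E = fun _ _ => 1
    · rw [if_pos (hiff.mpr h), if_pos h, mul_one]
    · rw [if_neg (fun h' => h (hiff.mp h')), if_neg h, mul_zero]
  simp_rw [hterm]
  rw [Finset.sum_ite_eq']
  have hmem : (fun _ _ => (1 : ℕ)) ∈ (Fintype.piFinset fun _ : Fin (p - 1) =>
      (univ : Finset (Fin (p - 1))).piAntidiag (p - 1)).filter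
        (fun E => ∀ j, ∑ i, E i j = p - 1) := by
    rw [Finset.mem_filter, Fintype.mem_piFinset]
    refine ⟨fun i => Finset.mem_piAntidiag.mpr ⟨?_, fun _ _ => Finset.mem_univ _⟩, fun j => ?_⟩
    · rw [Finset.sum_const, Finset.card_univ, Fintype.card_fin, smul_eq_mul, mul_one]
    · rw [Finset.sum_const, Finset.card_univ, Fintype.card_fin, smul_eq_mul, mul_one]
  rw [if_pos hmem]
  have hmult : Nat.multinomial (univ : Finset (Fin (p - 1))) (fun _ => 1) = (p - 1).factorial := by
    have := Nat.multinomial_spec (univ : Finset (Fin (p - 1))) (fun _ => (1 : ℕ))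
    simpa only [Nat.factorial_one, Finset.prod_const_one, one_mul, Finset.sum_const,
      Finset.card_univ, Fintype.card_fin, smul_eq_mul, mul_one] using this
  simp_rw [hmult]
  rw [ZMod.wilsons_lemma, Finset.prod_const, Finset.card_univ, Fintype.card_fin]

end Glynn

/-! ### Step 4: assembly -/

/-- **Glynn's congruence for the column-signed count**: for a prime `p`,
`latinColCount (p - 1) ≡ (-1)^{p-1} (mod p)` (Glynn's Thm. 3.2 in the column-sign normalisation:
the Alon–Tarsi count differs from it by the sign `sgn(τ)` of `sum_colSign_eq`).
[cite: Glynn2010AlonTarsi, Thm. 3.2] -/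
theorem cast_latinColCount_prime_sub_one (p : ℕ) [Fact p.Prime] :
    ((latinColCount (p - 1) : ℤ) : ZMod p) = (-1) ^ (p - 1) := by
  rw [cast_latinColCount_eq_coeff (ZMod p) (p - 1), coeff_allOnes_det_pow_card_sub_one]

/-- **Discharge of `Glynn2010_AlonTarsi`** [Glynn2010AlonTarsi, Thm. 3.2 and abstract: "the
number of even Latin squares of order `p − 1` is not equal to the number of odd Latin squares of
that order"]: for every odd prime `p`, `AlonTarsiConjecture (p - 1)`.
[cite: Glynn2010AlonTarsi, Thm. 3.2] -/
theorem Glynn2010_AlonTarsi_holds : Glynn2010_AlonTarsi := by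
  intro p hp hodd
  haveI : Fact p.Prime := ⟨hp⟩
  rw [← latinColCount_ne_zero_iff]
  intro h0
  have h := cast_latinColCount_prime_sub_one p
  rw [h0, Int.cast_zero, (Nat.Odd.sub_odd hodd odd_one).neg_one_pow] at h
  exact zero_ne_one h

/-- **Kumar's stretching theorem is unconditional in dimension `p - 1`** (`p` an odd prime): for
every partition `λ` with at most `p - 1` parts, `(p-1)·λ ∈ S(Det_{p-1})` — the instance
`kumar_stretching_prime_sub_one` fed with the two discharges `Kumar2015_stretching_holds` and
`Glynn2010_AlonTarsi_holds`. [cite: BurgisserHuttenhainIkenmeyer2017, Thm. 2 (Kumar)] -/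
theorem kumar_stretching_prime_sub_one_holds {p : ℕ} (hp : p.Prime) (hodd : Odd p) (D : ℕ)
    (lam : Nat.Partition D) (hlen : lam.parts.card ≤ p - 1) :
    (p - 1) • Weight.ofPartition ((p - 1) * (p - 1)) lam ∈ detOccWeights (p - 1) :=
  kumar_stretching_prime_sub_one Kumar2015_stretching_holds Glynn2010_AlonTarsi_holds hp hodd D
    lam hlen

/-! ### The exact values: Glynn's Thm. 2.1 / Cor. 2.3 (three parities) and Thm. 3.2 as printed -/

section ExactValue

/-- The sign of the coordinate swap `τ : (i,j) ↦ (j,i)` on `[n] × [n]`: a product of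
`\binom{n}{2}` disjoint transpositions, `sgn τ = (-1)^{n(n-1)/2}`. [folklore] -/
private theorem sign_prodComm_fin (n : ℕ) :
    ((Perm.sign (Equiv.prodComm (Fin n) (Fin n)) : ℤˣ) : ℤ) = (-1) ^ (n * (n - 1) / 2) := by
  classical
  set τ : Perm (Fin n × Fin n) := Equiv.prodComm (Fin n) (Fin n) with hτ
  have hsupp : τ.support = (univ : Finset (Fin n)).offDiag := by
    ext ⟨i, j⟩
    rw [Perm.mem_support, Finset.mem_offDiag, hτ, Equiv.prodComm_apply, Prod.swap_prod_mk]
    simp only [ne_eq, Prod.mk.injEq, Finset.mem_univ, true_and]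
    exact ⟨fun h hij => h ⟨hij.symm, hij⟩, fun h hji => h hji.2⟩
  have hcard : τ.support.card = n * (n - 1) := by
    rw [hsupp, Finset.offDiag_card, Finset.card_univ, Fintype.card_fin, Nat.mul_sub_one]
  by_cases hn : n * (n - 1) = 0
  · have h1 : τ = 1 := Perm.support_eq_empty_iff.mp (Finset.card_eq_zero.mp (hcard.trans hn))
    rw [h1, Perm.sign_one, Units.val_one, hn, Nat.zero_div, pow_zero]
  · have h2 : τ ^ 2 = 1 := by
      ext ⟨i, j⟩ <;> simp [hτ, pow_two]
    have hne : τ ≠ 1 := fun h1 => hn (by rw [← hcard, h1, Perm.support_one, Finset.card_empty])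
    have hord : orderOf τ = 2 := orderOf_eq_prime h2 hne
    obtain ⟨k, hk⟩ := Perm.cycleType_prime_order (σ := τ) (by rw [hord]; exact Nat.prime_two)
    rw [hord] at hk
    have hsum := Perm.sum_cycleType τ
    rw [hk, Multiset.sum_replicate, smul_eq_mul, hcard] at hsum
    rw [Perm.sign_of_cycleType, hk, Multiset.sum_replicate, Multiset.card_replicate, smul_eq_mul,
      Units.val_pow_eq_pow_val, Units.val_neg, Units.val_one]
    have hk2 : n * (n - 1) / 2 = k + 1 := by omega
    rw [hk2, pow_add, pow_mul', neg_one_sq, one_pow, one_mul]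

variable {n : ℕ}

/-- **Glynn's Thm. 2.1 (a result of R. Wilson) / Cor. 2.3, the three-parities relation with its
exact sign**: "for the Latin square `rowpar(L) + colpar(L) + sympar(L) ≡ m/2 (mod 2)`" (`m` even),
"`par(L) ≡ sympar(L) + m/2 (mod 2)`". In the tree's letters (`colSign (rowInv L)` is the symbol sign
of `L`, `latinSign = ε_R ε_C`): `ε_S(L) = (-1)^{n(n-1)/2} ε_R(L) ε_C(L)` for every `n` (for even `n`,
`n(n-1)/2 ≡ n/2 (mod 2)`); this is `colSign_rowInv` with `sgn(τ)` evaluated.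
[cite: Glynn2010AlonTarsi, Thm. 2.1 and Cor. 2.3] -/
theorem colSign_rowInv_eq_neg_one_pow_mul (L : Fin n → Fin n → Fin n) (h : IsLatinSquare L) :
    ((colSign (rowInv L h) (isLatinSquare_rowInv L h) : ℤˣ) : ℤ) =
      (-1) ^ (n * (n - 1) / 2) * ((latinSign L h : ℤˣ) : ℤ) := by
  rw [colSign_rowInv, Units.val_mul, sign_prodComm_fin]

open scoped Classical in
/-- The column-signed count as a sum over the subtype of Latin squares (the tree's `latinColCount`
sums `rectColSign` over Latin `(n,n)`-rectangles). [folklore] -/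
private theorem latinColCount_eq_sum_colSign (n : ℕ) :
    latinColCount n =
      ∑ L : {L : Fin n → Fin n → Fin n // IsLatinSquare L}, ((colSign L.1 L.2 : ℤˣ) : ℤ) := by
  unfold latinColCount
  rw [Finset.sum_subtype (p := fun L : Fin n → Fin n → Fin n => IsLatinSquare L)
    (univ.filter fun R : Fin n → Fin n → Fin n => IsLatinRect R)
    (fun L => by rw [Finset.mem_filter, isLatinRect_iff_isLatinSquare]; simp)]
  exact Finset.sum_congr rfl fun L _ => by rw [rectColSign_eq_colSign L.1 L.2]

open scoped Classical in
/-- **Glynn's Thm. 3.2 as printed**: "For any odd prime `p`, the number of even Latin squares of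
order `p − 1` minus the number of odd Latin squares of that order, is `(−1)^{(p−1)/2}` modulo `p`."
Here "even/odd" is Glynn's `par = rowpar + colpar` (Def. 2.2), i.e. the tree's `latinSign`, and the
signed count is the sum defining `AlonTarsiConjecture (p - 1)`. Proof: the count is
`sgn(τ) · latinColCount (p-1)` (`sum_colSign_eq`), `latinColCount (p-1) ≡ (-1)^{p-1} = 1`
(`cast_latinColCount_prime_sub_one`) and `sgn(τ) = (-1)^{(p-1)(p-2)/2} = (-1)^{(p-1)/2}`.
[cite: Glynn2010AlonTarsi, Thm. 3.2] -/
theorem glynn2010_thm_3_2 {p : ℕ} (hp : p.Prime) (hodd : Odd p) :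
    ((∑ L : {L : Fin (p - 1) → Fin (p - 1) → Fin (p - 1) // IsLatinSquare L},
        ((latinSign L.1 L.2 : ℤˣ) : ℤ) : ℤ) : ZMod p) = (-1) ^ ((p - 1) / 2) := by
  haveI : Fact p.Prime := ⟨hp⟩
  have h1 := sum_colSign_eq (n := p - 1)
  rw [← latinColCount_eq_sum_colSign] at h1
  have h2 : (∑ L : {L : Fin (p - 1) → Fin (p - 1) → Fin (p - 1) // IsLatinSquare L},
      ((latinSign L.1 L.2 : ℤˣ) : ℤ)) =
        ((Perm.sign (Equiv.prodComm (Fin (p - 1)) (Fin (p - 1))) : ℤˣ) : ℤ) *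
          latinColCount (p - 1) := by
    rw [h1, ← mul_assoc, ← Units.val_mul, Int.units_mul_self, Units.val_one, one_mul]
  rw [h2, Int.cast_mul, cast_latinColCount_prime_sub_one, (Nat.Odd.sub_odd hodd odd_one).neg_one_pow,
    mul_one, sign_prodComm_fin, Int.cast_pow, Int.cast_neg, Int.cast_one]
  apply neg_one_pow_congr
  obtain ⟨k, rfl⟩ := hodd
  have e1 : (2 * k + 1 - 1) * (2 * k + 1 - 1 - 1) / 2 = k * (2 * k - 1) := by
    rw [Nat.add_sub_cancel, show 2 * k * (2 * k - 1) = 2 * (k * (2 * k - 1)) by ring,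
      Nat.mul_div_cancel_left _ (by norm_num : 0 < 2)]
  have e2 : (2 * k + 1 - 1) / 2 = k := by
    rw [Nat.add_sub_cancel, Nat.mul_div_cancel_left _ (by norm_num : 0 < 2)]
  rw [e1, e2]
  constructor
  · intro h
    rcases Nat.even_mul.mp h with hk | hk
    · exact hk
    · have hk0 : k = 0 := by
        rw [Nat.even_iff] at hk
        omega
      rw [hk0]
      exact Even.zero
  · exact fun hk => hk.mul_right _

end ExactValue

end Literature.Barriers.ValiantsHypothesis
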